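import Literature.Probability.RandomPlanarGeometry.SAWManhattanBlocks
import Literature.Probability.RandomPlanarGeometry.SAWManhattanLtHex
import Literature.Probability.RandomPlanarGeometry.SAWFisherTransformation
import HarnessLib

/-!
# The planar connective constants are strictly ordered: `μ_L < μ_Manhattan < μ_hex < μ(ℤ²)`,
# and the `(3,12²)` lattice sits between the `L` lattice and the honeycomb

Topic `Literature/Probability/RandomPlanarGeometry` (glue over `SAWManhattanBlocks.lean` — `logMuAT_lt_logMuM`,
the `φ`-sandwich `μ_L ≤ φ < 81/50 ≤ μ_M` —, `SAWManhattanLtHex.lean` — `exp_logMuM_lt_hexConnectiveConstant`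
(no three consecutive turns in a Manhattan self-avoiding walk ⇒ tribonacci majorant `μ_M ≤ 46/25 < √(2+√2)`)
and `hexConnectiveConstant_lt_connectiveConstant` (`√(2+√2) < 2 ≤ μ(ℤ²)`, with Duminil-Copin–Smirnov's
`μ_hex = √(2+√2)` kernel-checked in `HexSAWTheorem1.lean`) —, `SAWFisherTransformation.lean` —
`fisherConnectiveConstant_bounds : 1.711041 < μ(3·12²) < 1.7110414` (Grimmett–Li 2013, Theorem 1(a), the Fisher
transformation of the honeycomb) — and `SAWBendingEnergyAllTurnWindow.lean` — `Zd.logMuAT_le_log_goldenRatio`).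

Numerically (Jensen–Guttmann 1998, Table 1; Malakis 1975; Enting–Guttmann 1985): `μ_L = 1.5657`,
`μ(3·12²) = 1.7110`, `μ_M = 1.7335`, `μ_hex = 1.84776`, `μ(ℤ²) = 2.63816`. Here the strict inequalities
`μ_L < μ_M < μ_hex < μ(ℤ²)` and `μ_L < μ(3·12²) < μ_hex` are theorems, with the explicit separating constants
`φ < 81/50`, `46/25`, `2` and `φ < 1.711041`, `1.7110414 < √(2+√2)`. The comparison of `μ(3·12²)` with `μ_M` is
NOT decided here (it would need `μ_M ≥ 1.712`; the tree has `μ_M ≥ 81/50`): an honest partial order on six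
planar constants (with `μ(ℤ²) < μ(𝕋)` of `SAWSquareLtTriangular.lean`). This file is glue/infrastructure over the
tree's enclosures, not a new estimate. (Lane «pcv-sawmu» R58; the `(3,12²)` links typed and proved by a-idea-2.)
-/

noncomputable section

open Literature.Probability.LatticeModels Literature.Probability.Percolation SimpleGraph

namespace Literature.Probability.RandomPlanarGeometry.SAW

namespace Zd

/-- **«2D-ORDER»: `μ_L < μ_Manhattan < μ_hex < μ(ℤ²)`** — the connective constants of the `L` lattice (all-turn
walks, `exp logMuAT`), the Manhattan lattice (`exp logMuM`), the hexagonal lattice and the square lattice are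
strictly ordered, with the separating constants `φ < 81/50` (block language vs. no three equal turns),
`46/25` (tribonacci majorant vs. `√(2+√2)`) and `2`. (a-idea-2's `Order2D`, body verbatim; the three links are
`logMuAT_lt_logMuM`, `exp_logMuM_lt_hexConnectiveConstant`, `hexConnectiveConstant_lt_connectiveConstant`.)
[cite: Malakis1975, abstract] [cite: DuminilCopinSmirnov2012, Theorem 1] -/
theorem planarConnectiveConstants_strictMono :
    Real.exp Zd.logMuAT < Real.exp logMuM ∧ Real.exp logMuM < hexConnectiveConstant ∧
      hexConnectiveConstant < SAW.connectiveConstant :=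
  ⟨Real.exp_lt_exp.2 logMuAT_lt_logMuM, exp_logMuM_lt_hexConnectiveConstant,
    hexConnectiveConstant_lt_connectiveConstant⟩

end Zd

/-! ### The `(3,12²)` lattice between the `L` lattice and the honeycomb -/

/-- `φ < 1.711041` (since `√5 < 2.4`). [folklore] -/
private theorem goldenRatio_lt_1711041 : (1 + Real.sqrt 5) / 2 < (1.711041 : ℝ) := by
  have h5 : Real.sqrt 5 < 2.4 := by
    rw [show (2.4 : ℝ) = Real.sqrt (2.4 ^ 2) by rw [Real.sqrt_sq (by norm_num)]]
    exact Real.sqrt_lt_sqrt (by norm_num) (by norm_num)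
  linarith

/-- **`μ_L < μ(3·12²)`**: the `L`-lattice (all-turn) constant is below the `(3,12²)` constant:
`μ_L ≤ φ = 1.618… < 1.711041 < μ(3·12²)` (the tree's `Zd.logMuAT_le_log_goldenRatio` and Grimmett–Li's lower
enclosure `fisherConnectiveConstant_bounds.1`; a-idea-2's `LLtFisher`). [cite: GrimmettLi2013Fisher, Theorem 1(a)]
[cite: Malakis1975, abstract] -/
theorem exp_logMuAT_lt_fisherConnectiveConstant : Real.exp Zd.logMuAT < fisherConnectiveConstant := by
  have h1 : Real.exp Zd.logMuAT ≤ (1 + Real.sqrt 5) / 2 := by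
    have hφ : (0 : ℝ) < (1 + Real.sqrt 5) / 2 := by positivity
    calc Real.exp Zd.logMuAT ≤ Real.exp (Real.log ((1 + Real.sqrt 5) / 2)) :=
          Real.exp_le_exp.2 Zd.logMuAT_le_log_goldenRatio
      _ = (1 + Real.sqrt 5) / 2 := Real.exp_log hφ
  have h2 := fisherConnectiveConstant_bounds.1
  have h3 := goldenRatio_lt_1711041
  linarith

/-- `1.7110414 < √(2+√2)` (since `√2 > 1.4` and `1.7110414² < 3.4`). [folklore] -/
private theorem lt_sqrt_two_add_sqrt_two : (1.7110414 : ℝ) < Real.sqrt (2 + Real.sqrt 2) := by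
  have h2 : (1.4 : ℝ) < Real.sqrt 2 := by
    rw [show (1.4 : ℝ) = Real.sqrt (1.4 ^ 2) by rw [Real.sqrt_sq (by norm_num)]]
    exact Real.sqrt_lt_sqrt (by norm_num) (by norm_num)
  rw [show (1.7110414 : ℝ) = Real.sqrt (1.7110414 ^ 2) by rw [Real.sqrt_sq (by norm_num)]]
  exact Real.sqrt_lt_sqrt (by norm_num) (by nlinarith)

/-- **`μ(3·12²) < μ(ℍ)`**: Grimmett–Li's upper enclosure `μ(3·12²) < 1.7110414` and Duminil-Copin–Smirnov's
`μ(ℍ) = √(2+√2) = 1.8477…` (a-idea-2's `FisherLtHex`). [cite: GrimmettLi2013Fisher, Theorem 1(a)]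
[cite: DuminilCopinSmirnov2012, Theorem 1] -/
theorem fisherConnectiveConstant_lt_hexConnectiveConstant : fisherConnectiveConstant < hexConnectiveConstant := by
  rw [hexConnectiveConstant_eq_of_thm1 DuminilCopinSmirnov2012_thm1_holds]
  exact fisherConnectiveConstant_bounds.2.trans lt_sqrt_two_add_sqrt_two

/-- **The `(3,12²)` lattice in the planar order**: `μ_L < μ(3·12²) < μ(ℍ)` (a-idea-2's `SixLatticeFisher`). Together
with `Zd.planarConnectiveConstants_strictMono` this is a partial order on the six planar constants
`μ_L < {μ_M, μ(3·12²)} < μ(ℍ) < μ(ℤ²) (< μ(𝕋))`; `μ(3·12²)` vs `μ_M` (`1.71104` vs `1.7335` numerically) is not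
decided in the kernel. [cite: GrimmettLi2013Fisher, Theorem 1(a)] [cite: DuminilCopinSmirnov2012, Theorem 1] -/
theorem sixLattice_fisher :
    Real.exp Zd.logMuAT < fisherConnectiveConstant ∧ fisherConnectiveConstant < hexConnectiveConstant :=
  ⟨exp_logMuAT_lt_fisherConnectiveConstant, fisherConnectiveConstant_lt_hexConnectiveConstant⟩

end Literature.Probability.RandomPlanarGeometry.SAW

end
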